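import Mathlib
import Summits.Ventures.LatticeQCDFlow.TrivializingMaps.AbelianRadius
import Summits.Ventures.LatticeQCDFlow.TrivializingMaps.AbelianContraction
import Summits.Ventures.LatticeQCDFlow.TrivializingMaps.MassTransferContraction
import HarnessLib

/-!
# The `U(1)` Lüscher step is an instance of the abstract mass-transfer contraction (interface validation; PROVED)

HONEST FRAMING: exact (Metropolis-corrected) sampling algorithms for lattice gauge theory; figures of merit
are autocorrelation/cost numbers at stated couplings and volumes; no continuum-physics claim.

Proposed tree file: `Summits/Ventures/LatticeQCDFlow/TrivializingMaps/AbelianMassTransfer.lean` (venture side;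
namespace `Summit.Ventures.LatticeQCDFlow.TrivializingMaps.Abelian.TermModes`). Everything here is PROVED
(no `sorry`, no new axioms).

PURPOSE. `MassTransferContraction.lean` proves the one-step contraction of THEORY-1 §12.3 for an ABSTRACT transfer
step `IsTransferStep K W σ γ Γ Sf Sb ν ν' T` ((T1) balance, (T2) emission, (T3) locality / weight shift, (G) gap), and
`LocalModeNorm.lean` packages a sequence of such steps dominating the `SU(n)` Lüscher recursion as the open obligation
`HasLocalModeNorm`. This file is the WITNESS that the abstract hypotheses are the right ones: the explicit compact-`U(1)`
Lüscher step `stepR K a` (`AbelianRadius.lean`) on an arbitrary finite plaquette complex `K` IS such a transfer step, with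
`κ = 1` (`‖m‖₁ ≤ c(m)`), `σ = 1` (`|χ_p(e)| ≤ 1`), `γ = g` (girth level), `Γ = 1`, `D = K.D`, so that the abstract
contraction `MassTransfer.linkMass_le` yields the factor `D·Γ·(1/κ + 8σ/γ) = D(1 + 8/g)` and RE-DERIVES the tree
theorem `abelianStepContraction` (`AbelianContraction.lean`): `abelianStepContraction_of_massTransfer`.
DICTIONARY (term modes). The abstract mode index is `TMode E P = Mode E ⊕ (Mode E × P × Bool)`: an input mode `n`
(`Sum.inl n`: weight `|n_e|`, Casimir `∑ n_e²`, mass `|a_n|`) or an OUTPUT TERM `(n, p, ±)` of `stepR` (`Sum.inr (n, p, s)`: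
the term `± (⟨χ_p,n⟩ a_n / 2) δ_{n ± χ_p} / c(n ± χ_p)`, underlying mode `n ± χ_p`, mass `|⟨χ_p,n⟩ a_n / 2| / c(n ± χ_p)`);
the transfer amount at the vertex `(p, e')` from `n` to `(n, p, ±)` is `|χ_p(e')| |n_{e'}| |a_n| / 2`. Indexing the
output by TERMS is exactly the triangle inequality of the paper proof; the output link mass dominates `N_e(stepR a)`
(`locNorm_stepR_le_linkMass`). (The full iteration would index by Lüscher PATHS `Mode E × List (P × Bool)`.) [ours]
-/

namespace Summit.Ventures.LatticeQCDFlow.TrivializingMaps.Abelian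

open Finset MassTransfer

variable {E P : Type*} [Fintype E] [Fintype P]

noncomputable section

namespace TermModes

/-- TERM MODES: an input mode, or an output term `(n, p, sign)` of one Lüscher step. [ours] -/
abbrev TMode (E P : Type*) := Mode E ⊕ (Mode E × P × Bool)

/-- `n + χ_p` (`true`) or `n - χ_p` (`false`). -/
def shift (K : PlaquetteComplex E P) (n : Mode E) (p : P) : Bool → Mode E
  | true => n + K.χ p
  | false => n - K.χ p

/-- The underlying `U(1)` mode of a term mode. -/
def um (K : PlaquetteComplex E P) : TMode E P → Mode E
  | Sum.inl n => n
  | Sum.inr (n, p, s) => shift K n p s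

/-- `n ± χ_p` has the shape required by `GirthAt`. -/
theorem shift_shape (K : PlaquetteComplex E P) (n : Mode E) (p : P) (s : Bool) :
    shift K n p s = n + K.χ p ∨ shift K n p s = n - K.χ p := by
  cases s <;> simp [shift]

/-- Coordinates: `(n ± χ_p)_e = n_e ± χ_p(e)`, so `|(n ± χ_p)_e| ≤ |n_e| + |χ_p(e)|` and `= |n_e|` off `p`. -/
theorem abs_shift_apply_le (K : PlaquetteComplex E P) (n : Mode E) (p : P) (s : Bool) (e : E) :
    |((shift K n p s) e : ℝ)| ≤ |(n e : ℝ)| + |(K.χ p e : ℝ)| := by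
  cases s
  · simp only [shift, Pi.sub_apply, Int.cast_sub]; exact abs_sub _ _
  · simp only [shift, Pi.add_apply, Int.cast_add]; exact abs_add_le _ _

/-- Off the plaquette the coordinates are unchanged. -/
theorem shift_apply_of_χ_eq_zero (K : PlaquetteComplex E P) (n : Mode E) (p : P) (s : Bool) {e : E}
    (he : K.χ p e = 0) : (shift K n p s) e = n e := by
  cases s <;> simp [shift, he]

/-- `‖n‖₁ - 4 ≤ ‖n ± χ_p‖₁`. -/
theorem l1_sub_four_le_l1_shift (K : PlaquetteComplex E P) (n : Mode E) (p : P) (s : Bool) :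
    l1 n - 4 ≤ l1 (shift K n p s) := by
  have hχ := K.l1_χ_le p
  cases s
  · have := l1_sub_le_l1_sub n (K.χ p); simp only [shift]; omega
  · have := l1_sub_le_l1_add n (K.χ p); simp only [shift]; omega

/-- MODE WEIGHTS of term modes: `w t e = |m_e|`, `c t = ∑_e m_e²` for the underlying mode `m`, `κ = 1`
(`‖m‖₁ ≤ c(m)`, `l1_le_normSq`). [ours] -/
def weights (K : PlaquetteComplex E P) : ModeWeights E (TMode E P) where
  w t e := |(um K t e : ℝ)|
  w_nonneg _ _ := abs_nonneg _
  c t := (normSq (um K t) : ℝ)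
  κ := 1
  κ_pos := one_pos
  casimir_ge t := by
    have h' : ((l1 (um K t) : ℤ) : ℝ) ≤ (normSq (um K t) : ℝ) := by exact_mod_cast l1_le_normSq (um K t)
    simpa [l1, Int.cast_sum, Int.cast_abs] using h'

/-- Total weight of a term mode = `‖m‖₁` of its underlying mode. -/
theorem tw_eq (K : PlaquetteComplex E P) (t : TMode E P) : (weights K).tw t = (l1 (um K t) : ℝ) := by
  simp [ModeWeights.tw, weights, l1, Int.cast_sum, Int.cast_abs]

/-- A plaquette has at most four links: `#{e : χ_p(e) ≠ 0} ≤ ‖χ_p‖₁ ≤ 4`. -/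
theorem card_links_le (K : PlaquetteComplex E P) (p : P) :
    (Finset.univ.filter fun e => K.χ p e ≠ 0).card ≤ 4 := by
  set s := Finset.univ.filter fun e => K.χ p e ≠ 0 with hs
  have h1 : (s.card : ℤ) ≤ ∑ e ∈ s, |K.χ p e| := by
    have h : ∀ e ∈ s, (1 : ℤ) ≤ |K.χ p e| := fun e he => Int.one_le_abs (by simpa [hs] using he)
    calc (s.card : ℤ) = ∑ e ∈ s, (1 : ℤ) := by simp
      _ ≤ ∑ e ∈ s, |K.χ p e| := Finset.sum_le_sum h
  have h2 : ∑ e ∈ s, |K.χ p e| ≤ l1 (K.χ p) := Finset.sum_le_univ_sum_of_nonneg fun e => abs_nonneg _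
  have h3 := K.l1_χ_le p
  omega

variable [DecidableEq E]

/-- The LINK COMPLEX of a plaquette complex: all plaquettes, `links p = {e : χ_p(e) ≠ 0}`, `D = K.D`. [ours] -/
def linkComplex (K : PlaquetteComplex E P) : LinkComplex E P where
  plaqs := Finset.univ
  links p := Finset.univ.filter fun e => K.χ p e ≠ 0
  card_links_le := card_links_le K
  D := K.D
  card_through_le e := by
    have h : (Finset.univ.filter fun p => e ∈ Finset.univ.filter fun e => K.χ p e ≠ 0)
        = Finset.univ.filter fun p => K.χ p e ≠ 0 := by ext p; simp
    rw [h]; exact K.card_filter_le e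

/-- `e ∈ links p ↔ χ_p(e) ≠ 0`. -/
@[simp] theorem mem_links (K : PlaquetteComplex E P) (p : P) (e : E) :
    e ∈ (linkComplex K).links p ↔ K.χ p e ≠ 0 := by simp [linkComplex]

variable (K : PlaquetteComplex E P) (a : Coeffs E)

/-- Input modes: the support of `a`. -/
def Sf : Finset (TMode E P) := a.support.map ⟨Sum.inl, Sum.inl_injective⟩

open scoped Classical in
/-- Output terms: `(n, p, ±)` with `n ∈ supp a` and `n ± χ_p ≠ 0` (the zero mode is projected out). -/
def Sb : Finset (TMode E P) :=
  ((a.support ×ˢ (Finset.univ : Finset (P × Bool))).map ⟨Sum.inr, Sum.inr_injective⟩).filter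
    fun t => um K t ≠ 0

/-- Input masses `|a_n|`. -/
def massIn : TMode E P → ℝ
  | Sum.inl n => |a n|
  | Sum.inr _ => 0

/-- Output masses: `|⟨χ_p,n⟩ a_n / 2| / c(n ± χ_p)` on the term `(n, p, ±)`. -/
def massOut : TMode E P → ℝ
  | Sum.inl _ => 0
  | Sum.inr (n, p, s) => |(pair (K.χ p) n : ℝ) * a n / 2| * ((normSq (shift K n p s) : ℝ))⁻¹

open scoped Classical in
/-- Transfer amounts: at the vertex `(p, e')`, from `n` to `(n, p, ±)`, the amount `|χ_p(e')| |n_{e'}| |a_n| / 2`. -/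
def transfer (p : P) (e' : E) : TMode E P → TMode E P → ℝ
  | Sum.inl n, Sum.inr (n', p', _) =>
      if n' = n ∧ p' = p then |(K.χ p e' : ℝ)| * |(n e' : ℝ)| * |a n| / 2 else 0
  | Sum.inl _, Sum.inl _ => 0
  | Sum.inr _, _ => 0

variable {K a}

omit [Fintype E] [Fintype P] [DecidableEq E] in
/-- Membership in the input set. -/
theorem mem_Sf {t : TMode E P} : t ∈ Sf a ↔ ∃ n ∈ a.support, t = Sum.inl n := by
  constructor
  · intro ht; obtain ⟨n, hn, rfl⟩ := Finset.mem_map.1 ht; exact ⟨n, hn, rfl⟩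
  · rintro ⟨n, hn, rfl⟩; exact Finset.mem_map.2 ⟨n, hn, rfl⟩

omit [Fintype E] [Fintype P] [DecidableEq E] in
/-- Input modes are the support of `a`. -/
theorem inl_mem_Sf {n : Mode E} (hn : n ∈ a.support) : (Sum.inl n : TMode E P) ∈ Sf a :=
  mem_Sf.2 ⟨n, hn, rfl⟩

omit [DecidableEq E] in
/-- Membership in the output set. -/
theorem mem_Sb {t : TMode E P} :
    t ∈ Sb K a ↔ ∃ n p s, t = Sum.inr (n, p, s) ∧ n ∈ a.support ∧ shift K n p s ≠ 0 := by
  constructor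
  · intro ht
    obtain ⟨ht1, ht0⟩ := Finset.mem_filter.1 ht
    obtain ⟨⟨n, p, s⟩, hx, rfl⟩ := Finset.mem_map.1 ht1
    exact ⟨n, p, s, rfl, (Finset.mem_product.1 hx).1, by simpa [um] using ht0⟩
  · rintro ⟨n, p, s, rfl, hn, h0⟩
    refine Finset.mem_filter.2 ⟨Finset.mem_map.2 ⟨(n, p, s), Finset.mem_product.2 ⟨hn, Finset.mem_univ _⟩, rfl⟩, ?_⟩
    simpa [um] using h0

omit [Fintype E] [Fintype P] [DecidableEq E] in
/-- Input masses are nonnegative. -/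
theorem massIn_nonneg (t : TMode E P) : 0 ≤ massIn a t := by
  rcases t with n | x; exacts [abs_nonneg _, le_rfl]

omit [DecidableEq E] in
/-- Transfer amounts are nonnegative. -/
theorem transfer_nonneg (p : P) (e' : E) (t t' : TMode E P) : 0 ≤ transfer K a p e' t t' := by
  rcases t with n | x <;> rcases t' with n' | ⟨n', p', s'⟩ <;> simp only [transfer, le_refl]
  split_ifs <;> positivity

omit [DecidableEq E] in
/-- A nonzero transfer goes from `n` to a term `(n, p, ±)` of the same plaquette. -/
theorem transfer_ne_zero {p : P} {e' : E} {t t' : TMode E P} (h : transfer K a p e' t t' ≠ 0) :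
    ∃ n s, t = Sum.inl n ∧ t' = Sum.inr (n, p, s) := by
  rcases t with n | x <;> rcases t' with n' | ⟨n', p', s'⟩
  · simp [transfer] at h
  · by_cases hc : n' = n ∧ p' = p
    · exact ⟨n, s', rfl, by rw [hc.1, hc.2]⟩
    · simp [transfer, hc] at h
  all_goals simp [transfer] at h

omit [DecidableEq E] in
/-- The transfer into the two terms `(n, p, ±)`, as an indicator bound (used for (T2)). -/
theorem transfer_le_indicator [DecidableEq P] (p : P) (e' : E) (n : Mode E) (t' : TMode E P) :
    transfer K a p e' (Sum.inl n) t' ≤ |(K.χ p e' : ℝ)| * |(n e' : ℝ)| * |a n| / 2 *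
      ((if t' = Sum.inr (n, p, true) then 1 else 0) + (if t' = Sum.inr (n, p, false) then 1 else 0)) := by
  have hC : 0 ≤ |(K.χ p e' : ℝ)| * |(n e' : ℝ)| * |a n| / 2 := by positivity
  rcases t' with n' | ⟨n', p', s'⟩
  · simp [transfer]
  · by_cases hc : n' = n ∧ p' = p
    · obtain ⟨rfl, rfl⟩ := hc
      cases s' <;> simp [transfer]
    · have h0 : transfer K a p e' (Sum.inl n) (Sum.inr (n', p', s')) = 0 := by simp [transfer, hc]
      rw [h0]
      refine mul_nonneg hC (add_nonneg ?_ ?_) <;> split_ifs <;> norm_num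

omit [DecidableEq E] in
/-- `|⟨χ_p, n⟩| ≤ ∑_{e'} |χ_p(e')| |n_{e'}|` in `ℝ`. -/
theorem abs_pair_real_le (K : PlaquetteComplex E P) (p : P) (n : Mode E) :
    |(pair (K.χ p) n : ℝ)| ≤ ∑ e', |(K.χ p e' : ℝ)| * |(n e' : ℝ)| := by
  have := abs_pair_le (K.χ p) n
  have h' : ((|pair (K.χ p) n| : ℤ) : ℝ) ≤ ((∑ e', |K.χ p e'| * |n e'| : ℤ) : ℝ) := by exact_mod_cast this
  simpa [Int.cast_abs, Int.cast_sum, Int.cast_mul] using h'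

/-- **The `U(1)` Lüscher step is an abstract transfer step** with `σ = 1`, `γ = g`, `Γ = 1` (and `κ = 1`,
`D = K.D` from `weights`, `linkComplex`), under the girth hypothesis `GirthAt K g a`, `g ≥ 1` (PROVED). [ours] -/
theorem isTransferStep {g : ℕ} (hg : 1 ≤ g) (hGirth : GirthAt K g a) :
    IsTransferStep (linkComplex K) (weights K) 1 (g : ℝ) 1 (Sf a) (Sb K a) (massIn a) (massOut K a)
      (transfer K a) := by
  classical
  have hgpos : (0 : ℝ) < g := by exact_mod_cast hg
  refine
    { σ_nonneg := zero_le_one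
      γ_pos := hgpos
      Γ_nonneg := zero_le_one
      ν_nonneg := fun t _ => massIn_nonneg t
      T_nonneg := fun p _ e' t t' => transfer_nonneg p e' t t'
      gap := ?_, balance := ?_, emit := ?_, local_off := ?_, local_on := ?_, tw_le := ?_ }
  · -- (G) gap from the girth hypothesis
    intro t' ht'
    obtain ⟨n, p, s, rfl, hn, h0⟩ := mem_Sb.1 ht'
    have hgm : (g : ℤ) ≤ normSq (shift K n p s) := hGirth n hn p _ (shift_shape K n p s) h0
    show (g : ℝ) ≤ (normSq (um K (Sum.inr (n, p, s))) : ℝ)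
    simp only [um]; exact_mod_cast hgm
  · -- (T1) balance: `c(m) |b-term| = |⟨χ_p,n⟩ a_n| / 2 ≤ ∑_{e' ∈ p} |χ_p(e')| |n_{e'}| |a_n| / 2`
    intro t' ht'
    obtain ⟨n, p, s, rfl, hn, h0⟩ := mem_Sb.1 ht'
    have hc0 : (normSq (shift K n p s) : ℝ) ≠ 0 := by
      have h' : (1 : ℝ) ≤ (normSq (shift K n p s) : ℝ) := by exact_mod_cast one_le_normSq h0
      linarith
    have hlhs : (weights K).c (Sum.inr (n, p, s)) * massOut K a (Sum.inr (n, p, s)) =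
        |(pair (K.χ p) n : ℝ)| * |a n| / 2 := by
      simp only [weights, um, massOut]
      rw [abs_div, abs_mul, abs_two]
      field_simp
    rw [hlhs]
    have hterm : ∀ e' ∈ (linkComplex K).links p,
        transfer K a p e' (Sum.inl n) (Sum.inr (n, p, s)) = |(K.χ p e' : ℝ)| * |(n e' : ℝ)| * |a n| / 2 := by
      intro e' _; simp [transfer]
    calc |(pair (K.χ p) n : ℝ)| * |a n| / 2
        ≤ (∑ e', |(K.χ p e' : ℝ)| * |(n e' : ℝ)|) * |a n| / 2 := by
          gcongr; exact abs_pair_real_le K p n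
      _ = ∑ e', |(K.χ p e' : ℝ)| * |(n e' : ℝ)| * |a n| / 2 := by
          rw [Finset.sum_mul, Finset.sum_div]
      _ = ∑ e' ∈ (linkComplex K).links p, |(K.χ p e' : ℝ)| * |(n e' : ℝ)| * |a n| / 2 := by
          refine (Finset.sum_subset (Finset.subset_univ _) fun e' _ he' => ?_).symm
          have hχ : K.χ p e' = 0 := by by_contra h; exact he' ((mem_links K p e').2 h)
          simp [hχ]
      _ = ∑ e' ∈ (linkComplex K).links p, transfer K a p e' (Sum.inl n) (Sum.inr (n, p, s)) :=
          Finset.sum_congr rfl fun e' he' => (hterm e' he').symm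
      _ ≤ ∑ e' ∈ (linkComplex K).links p, ∑ t ∈ Sf a, transfer K a p e' t (Sum.inr (n, p, s)) := by
          refine Finset.sum_le_sum fun e' _ => ?_
          exact Finset.single_le_sum (f := fun t => transfer K a p e' t (Sum.inr (n, p, s)))
            (fun t _ => transfer_nonneg p e' t _) (inl_mem_Sf hn)
      _ ≤ ∑ p' ∈ (linkComplex K).plaqs, ∑ e' ∈ (linkComplex K).links p',
            ∑ t ∈ Sf a, transfer K a p' e' t (Sum.inr (n, p, s)) := by
          refine Finset.single_le_sum
            (f := fun p' => ∑ e' ∈ (linkComplex K).links p', ∑ t ∈ Sf a, transfer K a p' e' t (Sum.inr (n, p, s)))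
            (fun p' _ => Finset.sum_nonneg fun e' _ => Finset.sum_nonneg fun t _ => transfer_nonneg p' e' t _)
            (Finset.mem_univ p)
  · -- (T2) emit: at most `|χ_p(e')| |n_{e'}| |a_n| ≤ |n_{e'}| |a_n|` leaves `n` through the vertex `(p, e')`
    intro p _ e' _ t ht
    obtain ⟨n, hn, rfl⟩ := mem_Sf.1 ht
    have hC : 0 ≤ |(K.χ p e' : ℝ)| * |(n e' : ℝ)| * |a n| / 2 := by positivity
    have hι : ∀ x : TMode E P, ∑ t' ∈ Sb K a, (if t' = x then (1 : ℝ) else 0) ≤ 1 := by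
      intro x
      rw [Finset.sum_ite_eq' (Sb K a) x (fun _ => (1 : ℝ))]
      split_ifs <;> norm_num
    calc ∑ t' ∈ Sb K a, transfer K a p e' (Sum.inl n) t'
        ≤ ∑ t' ∈ Sb K a, |(K.χ p e' : ℝ)| * |(n e' : ℝ)| * |a n| / 2 *
            ((if t' = Sum.inr (n, p, true) then 1 else 0) + (if t' = Sum.inr (n, p, false) then 1 else 0)) :=
          Finset.sum_le_sum fun t' _ => transfer_le_indicator p e' n t'
      _ = |(K.χ p e' : ℝ)| * |(n e' : ℝ)| * |a n| / 2 *
            ((∑ t' ∈ Sb K a, if t' = Sum.inr (n, p, true) then (1 : ℝ) else 0) +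
              ∑ t' ∈ Sb K a, if t' = Sum.inr (n, p, false) then (1 : ℝ) else 0) := by
          rw [← Finset.mul_sum, Finset.sum_add_distrib]
      _ ≤ |(K.χ p e' : ℝ)| * |(n e' : ℝ)| * |a n| / 2 * (1 + 1) := by
          gcongr <;> exact hι _
      _ = |(K.χ p e' : ℝ)| * (|(n e' : ℝ)| * |a n|) := by ring
      _ ≤ 1 * (|(n e' : ℝ)| * |a n|) := by
          gcongr; exact_mod_cast K.abs_χ_le p e'
      _ = 1 * (weights K).w (Sum.inl n) e' * massIn a (Sum.inl n) := by
          simp only [weights, um, massIn]; ring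
  · -- (T3a) off the plaquette the weights are unchanged
    intro p _ e' t t' hT e he
    obtain ⟨n, s, rfl, rfl⟩ := transfer_ne_zero hT
    have hχ : K.χ p e = 0 := by by_contra h; exact he ((mem_links K p e).2 h)
    show |((um K (Sum.inr (n, p, s))) e : ℝ)| ≤ |((um K (Sum.inl n)) e : ℝ)|
    simp only [um]
    rw [shift_apply_of_χ_eq_zero K n p s hχ]
  · -- (T3b) on the plaquette the weights grow by at most `|χ_p(e)| ≤ 1`
    intro p _ e' t t' hT e _
    obtain ⟨n, s, rfl, rfl⟩ := transfer_ne_zero hT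
    show |((um K (Sum.inr (n, p, s))) e : ℝ)| ≤ |((um K (Sum.inl n)) e : ℝ)| + 1
    simp only [um]
    calc |((shift K n p s) e : ℝ)| ≤ |(n e : ℝ)| + |(K.χ p e : ℝ)| := abs_shift_apply_le K n p s e
      _ ≤ |(n e : ℝ)| + 1 := by gcongr; exact_mod_cast K.abs_χ_le p e
  · -- (T3c) the total weight drops by at most `‖χ_p‖₁ ≤ 4`
    intro p _ e' t t' hT
    obtain ⟨n, s, rfl, rfl⟩ := transfer_ne_zero hT
    rw [tw_eq, tw_eq]
    simp only [um]
    have h' : ((l1 n : ℤ) : ℝ) - 4 ≤ (l1 (shift K n p s) : ℝ) := by exact_mod_cast l1_sub_four_le_l1_shift K n p s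
    linarith

omit [DecidableEq E] in
/-- The input link mass is the local norm `N_e(a)`. -/
theorem linkMass_in (e : E) : (weights K).linkMass (Sf a) (massIn a) e = locNorm e a := by
  rw [LocNorm.eq_sum_of_support_subset e a subset_rfl]
  unfold ModeWeights.linkMass Sf
  rw [Finset.sum_map]
  rfl

omit [DecidableEq E] in
/-- The output link mass dominates the local norm `N_e(stepR a)` (triangle inequality over the terms). -/
theorem locNorm_stepR_le_linkMass (e : E) :
    locNorm e (stepR K a) ≤ (weights K).linkMass (Sb K a) (massOut K a) e := by
  classical
  -- the term-wise majorant of the tree proof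
  have h1 : locNorm e (stepR K a) ≤ ∑ n ∈ a.support, ∑ p,
      |(pair (K.χ p) n : ℝ)| * |a n| / 2 *
        (|((n - K.χ p) e : ℝ)| * ((normSq (n - K.χ p) : ℝ))⁻¹ +
          |((n + K.χ p) e : ℝ)| * ((normSq (n + K.χ p) : ℝ))⁻¹) := by
    unfold stepR
    refine (LocNorm.finsupp_sum_le e a _).trans (Finset.sum_le_sum fun n _ => ?_)
    exact (LocNorm.finset_sum_le e _ _).trans (Finset.sum_le_sum fun p _ => locNorm_stepTerm_le K e n (a n) p)
  -- the output link mass, summed over ALL terms (the projected-out zero modes contribute nothing)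
  have h2 : (weights K).linkMass (Sb K a) (massOut K a) e =
      ∑ x ∈ a.support ×ˢ (Finset.univ : Finset (P × Bool)),
        |((shift K x.1 x.2.1 x.2.2) e : ℝ)| * massOut K a (Sum.inr x) := by
    unfold ModeWeights.linkMass Sb
    rw [Finset.sum_filter_of_ne, Finset.sum_map]
    · rfl
    · intro t ht hne
      obtain ⟨⟨n, p, s⟩, _, rfl⟩ := Finset.mem_map.1 ht
      intro h0
      apply hne
      have h0' : shift K n p s = 0 := by simpa [um] using h0
      show |((um K (Sum.inr (n, p, s))) e : ℝ)| * _ = 0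
      simp [um, h0']
  rw [h2, Finset.sum_product]
  refine h1.trans (Finset.sum_le_sum fun n _ => ?_)
  rw [Fintype.sum_prod_type]
  refine Finset.sum_le_sum fun p _ => le_of_eq ?_
  rw [Fintype.sum_bool]
  simp only [massOut, shift]
  rw [abs_div, abs_mul, abs_two]
  ring

omit [DecidableEq E] in
/-- **`AbelianStepContraction K` from `MassTransfer.linkMass_le` (ours; PROVED).** The abstract one-step
contraction, instantiated on term modes with `κ = σ = Γ = 1`, `γ = g`, `D = K.D`, gives exactly the `U(1)`
factor `D (1 + 8/g)` of `abelianStepContraction`. [ours] -/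
theorem abelianStepContraction_of_massTransfer (K : PlaquetteComplex E P) : AbelianStepContraction K := by
  classical
  intro g hg a M hGirth hM e
  have hstep := isTransferStep (K := K) (a := a) hg hGirth
  have hN : ∀ e, (weights K).linkMass (Sf a) (massIn a) e ≤ M := fun e => by
    rw [linkMass_in]; exact hM e
  have h := MassTransfer.linkMass_le hstep hN e
  have hD : ((linkComplex K).D : ℝ) = K.D := rfl
  have hκ : (weights K).κ = 1 := rfl
  rw [hD, hκ] at h
  calc locNorm e (stepR K a) ≤ (weights K).linkMass (Sb K a) (massOut K a) e := locNorm_stepR_le_linkMass e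
    _ ≤ K.D * 1 * (1 / 1 + 8 * 1 / (g : ℝ)) * M := h
    _ = K.D * (1 + 8 / (g : ℝ)) * M := by ring

end TermModes

end

end Summit.Ventures.LatticeQCDFlow.TrivializingMaps.Abelian
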